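import Summits.BirchSwinnertonDyer.BirchSwinnertonDyer.Theorems.ThetaPartnerAtTwoSignedKatoUpToAtTwoFrameLifts
import Summits.BirchSwinnertonDyer.BirchSwinnertonDyer.Theorems.ThetaPartnerAtTwoSignedKatoUpToAtTwoLayerPairingLiterature
import Summits.BirchSwinnertonDyer.BirchSwinnertonDyer.Theorems.KatoDescentPotSupersingularZetaBodyRefitUnconditional
import Literature.NumberTheory.GaloisRepresentations.ContinuousCorestrictionRelConj
import Literature.NumberTheory.EllipticCurves.Sprung2012.ColemanMapLambdaActionProofs
import HarnessLib

/-!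
# K3 `SignedKatoDivisibilityUpToAtTwo`, line `colemanrat` — FRAME-B: changing the COHERENT TOWER of `2`-power embeddings in the
# Kato pairing fact by a Galois element, absorbed by conjugating the Euler system (in the kernel)

Cell `pub/bsd-wall`, width seat `bsd-wall-tp2-p2x-w3` g11, `--supports stmt-BirchSwinnertonDyer-20308` (helper; closes nothing).
The named fact `F := Kato2004.exists_eulerSystem_expStar_tatePairing_values_two` (p640688) quantifies over EVERY coherent tower
`e_k : ℚ(ζ_{2^k}) → ℚ̄₂` (print fixes one). Step B of the lead's audit `Cruxes/SignedKatoDivisibilityUpToAtTwo/G9-LEAD-AUDIT.md` §4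
says: replacing `e` by `ψ ∘ e` (`ψ ∈ G_{ℚ₂}`) is absorbed by conjugating the Euler system `z` by ONE global element
`σ̃ = resGalOfEmb closureEmb ψ_v ∈ Γ_ℚ` (`ψ_v ∈ Γ_v` the transport of `ψ` along the frame) and composing the value datum `Λ` with
`σ̃⁻¹`. This file proves it IN THE KERNEL, assembling parts that already exist in the tree:

* `levelToLayerTwo_conjMap` — `Cor_{ℚ(μ_{2^{n+2}})/ℚ_n}` commutes with `Γ_ℚ` (`coresLe_conjMap`);
* `tatePairingPk_conjMap` — (P2_k) for THE layer Tate pairings: `⟨σ̃•y, g•Q⟩ = ⟨y, Q⟩`, `σ̃ = resGalOfEmb closureEmb g`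
  (`LayerPairing.layerPairingPk_conjMap` through the `rfl` bridge `layerPairingPk_weilTowerPk_eq_tatePairingPk`);
* `kz_clause_towerChange` — the (KZ) clause for `(e, τ)` at the point `ψ⁻¹_* Q₀` and the class `y` gives the (KZ) clause for
  `(ψ ∘ e, ψ τ ψ⁻¹)` at `Q₀` and the class `σ̃ • y`, SAME `t`;
* `expStarTatePairing_body_towerChange` — the body of `F` (from `∃ κ_K` on) at `(Φ, e, τ)` implies the body at `(Φ, ψ ∘ e, ψ τ ψ⁻¹)`
  with witnesses `(κ_K, Λ ∘ σ̃⁻¹, σ̃ • z, x)`: `ZetaBody` is transported by `ZetaBodyRefit.zetaBody_refit_unconditional` (the kmc seat's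
  group-ring refit at `c₀ = 0`: Euler systems are a `ℤ₂[Γ_ℚ]`-module, unramifiedness/locality are `Γ_ℚ`-stable, equivariance and
  `Λ(z) = 1 ⊗ x` survive), the (KZ) clause by `kz_clause_towerChange`.

Theorems only (no `def`, no fact, no instance); standard axioms. Sequel (`…FramePrint.lean`): any two coherent towers differ by
such a `ψ` (compactness of `G_{ℚ₂}`), whence `F` ⟺ its print-shaped ONE-FRAME-ONE-TOWER form. HONEST FRAMING: `F` stays a named,
unproved, print fact; nothing here settles K3/K3P′; BSD is not proved by any of this.
-/

noncomputable section

open scoped Classical NumberField TensorProduct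
open Field IsDedekindDomain CongruenceSubgroup NumberField WeierstrassCurve
open Literature.NumberTheory.GaloisRepresentations
open Literature.NumberTheory.EllipticCurves Literature.NumberTheory.EllipticCurves.ModularForms
open Literature.NumberTheory.EllipticCurves.Rank1Residual Literature.NumberTheory.EllipticCurves.Kobayashi2003
open Literature.NumberTheory.EllipticCurves.Kato2004 Literature.NumberTheory.EllipticCurves.Kato2004.EulerSystemValues
open Literature.NumberTheory.EllipticCurves.Sprung2012
open ZpExtension

set_option linter.dupNamespace false

namespace Summit.BirchSwinnertonDyer.BirchSwinnertonDyer.Theorems.SignedKatoOffTwo.FrameChange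

/-! ## §1 `Γ_ℚ`-equivariance of `Cor` and (P2_k) for THE layer Tate pairings -/

section Equivariance

variable {W : WeierstrassCurve ℚ} [W.IsElliptic] {κ : ZpExtension ℚ 2} (hκ : κ.IsCyclotomic)
  [ContinuousSMul ℤ_[2] (W.tateModule 2)]

/-- **`Cor_{ℚ(μ_{2^{n+2}})/ℚ_n}` is `Γ_ℚ`-equivariant**: `levelToLayerTwo (σ̃ • y) = σ̃ • levelToLayerTwo y` (`coresLe_conjMap` for
the normal pair `Gal(ℚ̄/ℚ(μ_{2^{n+2}})) ≤ Gal(ℚ̄/ℚ_n)`). [cite: NeukirchSchmidtWingberg2008, I §5 Prop. 1.5.4] -/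
theorem levelToLayerTwo_conjMap (S : Set (HeightOneSpectrum (𝓞 ℚ))) (n : ℕ) (g : absoluteGaloisGroup ℚ)
    (y : H1 (tateRep W 2) ((cyclotomicLevelsRat 2 S).level (n + 2) ∅)) :
    levelToLayerTwo W hκ S n (conjMap (tateRep W 2).toTopRep ((cyclotomicLevelsRat 2 S).level (n + 2) ∅) g 1 y) =
      conjMap (tateRep W 2).toTopRep (κ.layerSubgroup n) g 1 (levelToLayerTwo W hκ S n y) := by
  letI : ((cyclotomicLevelsRat 2 S).level (n + 2) ∅).FiniteIndex :=
    finiteIndex_of_isOpen_of_compactSpace _ ((cyclotomicLevelsRat 2 S).isOpen_level (n + 2) ∅)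
  letI : Fintype (κ.layerSubgroup n ⧸ ((cyclotomicLevelsRat 2 S).level (n + 2) ∅).subgroupOf (κ.layerSubgroup n)) :=
    Fintype.ofFinite _
  have h := coresLe_conjMap (tateRep W 2).toTopRep (hκ.cyclotomicLevelsRat_level_le_layerSubgroup_two S n)
    ((cyclotomicLevelsRat 2 S).isOpen_level (n + 2) ∅) g y
  unfold levelToLayerTwo
  convert h using 2

variable (κ) (v : HeightOneSpectrum (𝓞 ℚ))

/-- **(P2_k) for THE layer Tate pairings of the tree**: `tatePairingPk (σ̃ • y) (g • Q) = tatePairingPk y Q` for `g ∈ Γ_v`,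
`σ̃ = resGalOfEmb closureEmb g` (`LayerPairing.layerPairingPk_conjMap` read through the `rfl` bridge
`layerPairingPk_weilTowerPk_eq_tatePairingPk`). [cite: Kobayashi2003, (8.23) (p. 18)] -/
theorem tatePairingPk_conjMap (n k : ℕ) (g : absoluteGaloisGroup (v.adicCompletion ℚ))
    (y : H1 (tateRep W 2) (κ.layerSubgroup n)) (Q : localPoints W (v.adicCompletion ℚ))
    (hQ : Q ∈ localLayerPointsOfEmb κ (closureEmb (K := ℚ) (v.adicCompletion ℚ)) W n) :
    CyclotomicLayer.tatePairingPk W κ v n k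
        (conjMap (tateRep W 2).toTopRep (κ.layerSubgroup n) (resGalOfEmb (closureEmb (K := ℚ) (v.adicCompletion ℚ)) g) 1 y)
        ⟨g • Q, smul_mem_localLayerPointsOfEmb κ (closureEmb (K := ℚ) (v.adicCompletion ℚ)) W n g hQ⟩ =
      CyclotomicLayer.tatePairingPk W κ v n k y ⟨Q, hQ⟩ := by
  rw [← LayerPairing.layerPairingPk_weilTowerPk_eq_tatePairingPk]
  exact LayerPairing.layerPairingPk_conjMap W κ v _ _ _ _ _ n k g y Q hQ

end Equivariance

/-! ## §2 The (KZ) clause under a change of tower `e ↦ ψ ∘ e` -/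

section Tower

variable {v : HeightOneSpectrum (𝓞 ℚ)} {W : WeierstrassCurve ℚ}

/-- `Φ_* (ψ⁻¹_* Q) = ψ_v⁻¹ • Φ_* Q` for the transport `ψ_v ∈ Γ_v` of `ψ` (`ψ_v • Φ x = Φ (ψ • x)`); `gi` = the action of `ψ⁻¹` as a
`ℚ`-algebra map. [folklore] -/
theorem map_frame_map_galInv (Φ : AlgebraicClosure ℚ_[2] ≃ₐ[ℚ] AlgebraicClosure (v.adicCompletion ℚ))
    (ψ : Field.absoluteGaloisGroup ℚ_[2]) (ψv : absoluteGaloisGroup (v.adicCompletion ℚ))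
    (hψv : ∀ x : AlgebraicClosure ℚ_[2], ψv • Φ x = Φ (ψ • x))
    (gi : AlgebraicClosure ℚ_[2] →ₐ[ℚ] AlgebraicClosure ℚ_[2]) (hgi : ∀ x, gi x = ψ⁻¹ • x)
    (Q : (W.baseChange (AlgebraicClosure ℚ_[2])).toAffine.Point) :
    WeierstrassCurve.Affine.Point.map (W' := W) (Φ : AlgebraicClosure ℚ_[2] →ₐ[ℚ] AlgebraicClosure (v.adicCompletion ℚ))
        (WeierstrassCurve.Affine.Point.map (W' := W) gi Q) =
      ψv⁻¹ • (show localPoints W (v.adicCompletion ℚ) from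
        WeierstrassCurve.Affine.Point.map (W' := W) (Φ : AlgebraicClosure ℚ_[2] →ₐ[ℚ] AlgebraicClosure (v.adicCompletion ℚ)) Q) := by
  rw [localPoints.smul_def, WeierstrassCurve.Affine.Point.map_map]
  change _ = WeierstrassCurve.Affine.Point.map (W' := W) _ (WeierstrassCurve.Affine.Point.map (W' := W) _ Q)
  rw [WeierstrassCurve.Affine.Point.map_map]
  refine congrArg (fun g' : AlgebraicClosure ℚ_[2] →ₐ[ℚ] AlgebraicClosure (v.adicCompletion ℚ) =>
    WeierstrassCurve.Affine.Point.map (W' := W) g' Q) (AlgHom.ext fun x => ?_)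
  rw [AlgHom.comp_apply, AlgHom.comp_apply, hgi]
  change Φ (ψ⁻¹ • x) = ψv⁻¹ • Φ x
  rw [eq_inv_smul_iff, hψv, smul_inv_smul]

variable [W.IsElliptic] (κ : ZpExtension ℚ 2) [ContinuousSMul ℤ_[2] (W.tateModule 2)]

/-- **The (KZ) clause under `e ↦ ψ ∘ e`.** Let `(Φ, φ)` be a continuous frame, `ψ ∈ G_{ℚ₂}` with transport `ψ_v ∈ Γ_v`, and
`σ̃ := resGalOfEmb closureEmb ψ_v ∈ Γ_ℚ`. If the class `y` pairs with `Φ_*(ψ⁻¹_* Q₀)` to `t` and `t` satisfies the value identity for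
`(e, τ)` at `ψ⁻¹_* Q₀`, then `σ̃ • y` pairs with `Φ_* Q₀` to `t` and `t` satisfies the value identity for `(ψ ∘ e, ψ τ ψ⁻¹)` at `Q₀`
((P2_k) `tatePairingPk_conjMap`; `ψ` fixes `ℚ₂` and passes the formal-log `tsum`). [folklore] -/
theorem kz_clause_towerChange (Φ : AlgebraicClosure ℚ_[2] ≃ₐ[ℚ] AlgebraicClosure (v.adicCompletion ℚ))
    (ψ : Field.absoluteGaloisGroup ℚ_[2]) (ψv : absoluteGaloisGroup (v.adicCompletion ℚ))
    (hψv : ∀ x : AlgebraicClosure ℚ_[2], ψv • Φ x = Φ (ψ • x))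
    (g gi : AlgebraicClosure ℚ_[2] →ₐ[ℚ] AlgebraicClosure ℚ_[2]) (hg : ∀ x, g x = ψ • x) (hgi : ∀ x, gi x = ψ⁻¹ • x)
    {n : ℕ} (e : CyclotomicField (cycLevel 2 (n + 2) ∅) ℚ →ₐ[ℚ] PadicAlgCl 2)
    (τ : ZMod (2 ^ (n + 2)) → Field.absoluteGaloisGroup ℚ_[2]) (y : H1 (tateRep W 2) (κ.layerSubgroup n))
    (xv : CyclotomicField (cycLevel 2 (n + 2) ∅) ℚ) (a : ℕ → ℚ_[2]) (Q₀ : localPoints W ℚ_[2])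
    (hQv : WeierstrassCurve.Affine.Point.map (W' := W)
        (Φ : AlgebraicClosure ℚ_[2] →ₐ[ℚ] AlgebraicClosure (v.adicCompletion ℚ))
        (show (W.baseChange (AlgebraicClosure ℚ_[2])).toAffine.Point from Q₀) ∈
      localLayerPointsOfEmb κ (closureEmb (K := ℚ) (v.adicCompletion ℚ)) W n)
    (hQv₁ : WeierstrassCurve.Affine.Point.map (W' := W)
        (Φ : AlgebraicClosure ℚ_[2] →ₐ[ℚ] AlgebraicClosure (v.adicCompletion ℚ))
        (show (W.baseChange (AlgebraicClosure ℚ_[2])).toAffine.Point from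
          (show localPoints W ℚ_[2] from
            WeierstrassCurve.Affine.Point.map (W' := W) gi (show (W.baseChange (AlgebraicClosure ℚ_[2])).toAffine.Point from Q₀))) ∈
      localLayerPointsOfEmb κ (closureEmb (K := ℚ) (v.adicCompletion ℚ)) W n)
    (t : ℤ_[2])
    (ht : ∀ k : ℕ, CyclotomicLayer.tatePairingPk W κ v n k y ⟨_, hQv₁⟩ = PadicInt.toZModPow k t)
    (htval : algebraMap ℚ_[2] (PadicAlgCl 2) (t : ℚ_[2]) =
      ∑ b : (ZMod (2 ^ (n + 2)))ˣ, τ (b : ZMod (2 ^ (n + 2))) •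
        ((∑' i : ℕ, algebraMap ℚ_[2] (PadicAlgCl 2) (a i) *
            (WeierstrassCurve.Affine.Point.zCoord
              (show (W.baseChange (AlgebraicClosure ℚ_[2])).toAffine.Point from
                (show localPoints W ℚ_[2] from
                  WeierstrassCurve.Affine.Point.map (W' := W) gi
                    (show (W.baseChange (AlgebraicClosure ℚ_[2])).toAffine.Point from Q₀)))) ^ i) *
          e xv)) :
    (∀ k : ℕ, CyclotomicLayer.tatePairingPk W κ v n k
        (conjMap (tateRep W 2).toTopRep (κ.layerSubgroup n) (resGalOfEmb (closureEmb (K := ℚ) (v.adicCompletion ℚ)) ψv) 1 y)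
        ⟨_, hQv⟩ = PadicInt.toZModPow k t) ∧
      algebraMap ℚ_[2] (PadicAlgCl 2) (t : ℚ_[2]) =
        ∑ b : (ZMod (2 ^ (n + 2)))ˣ, (ψ * τ (b : ZMod (2 ^ (n + 2))) * ψ⁻¹) •
          ((∑' i : ℕ, algebraMap ℚ_[2] (PadicAlgCl 2) (a i) *
              (WeierstrassCurve.Affine.Point.zCoord (show (W.baseChange (AlgebraicClosure ℚ_[2])).toAffine.Point from Q₀)) ^ i) *
            (g.comp e) xv) := by
  have hpt := map_frame_map_galInv (W := W) Φ ψ ψv hψv gi hgi (show (W.baseChange (AlgebraicClosure ℚ_[2])).toAffine.Point from Q₀)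
  refine ⟨fun k => ?_, ?_⟩
  · -- residues: `⟨σ̃•y, Φ Q₀⟩ = ⟨σ̃•y, ψ_v • ψ_v⁻¹ • Φ Q₀⟩ = ⟨y, ψ_v⁻¹ • Φ Q₀⟩ = ⟨y, Φ (ψ⁻¹ Q₀)⟩`
    have hmem : ψv⁻¹ • (show localPoints W (v.adicCompletion ℚ) from
        WeierstrassCurve.Affine.Point.map (W' := W) (Φ : AlgebraicClosure ℚ_[2] →ₐ[ℚ] AlgebraicClosure (v.adicCompletion ℚ))
          (show (W.baseChange (AlgebraicClosure ℚ_[2])).toAffine.Point from Q₀)) ∈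
        localLayerPointsOfEmb κ (closureEmb (K := ℚ) (v.adicCompletion ℚ)) W n :=
      smul_mem_localLayerPointsOfEmb κ (closureEmb (K := ℚ) (v.adicCompletion ℚ)) W n ψv⁻¹ hQv
    have hsub : (⟨_, hQv⟩ : localLayerPointsOfEmb κ (closureEmb (K := ℚ) (v.adicCompletion ℚ)) W n) =
        ⟨ψv • ψv⁻¹ • (show localPoints W (v.adicCompletion ℚ) from
          WeierstrassCurve.Affine.Point.map (W' := W) (Φ : AlgebraicClosure ℚ_[2] →ₐ[ℚ] AlgebraicClosure (v.adicCompletion ℚ))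
            (show (W.baseChange (AlgebraicClosure ℚ_[2])).toAffine.Point from Q₀)),
          smul_mem_localLayerPointsOfEmb κ (closureEmb (K := ℚ) (v.adicCompletion ℚ)) W n ψv hmem⟩ :=
      Subtype.ext (smul_inv_smul ψv _).symm
    have hsub₁ : (⟨_, hmem⟩ : localLayerPointsOfEmb κ (closureEmb (K := ℚ) (v.adicCompletion ℚ)) W n) = ⟨_, hQv₁⟩ :=
      Subtype.ext hpt.symm
    rw [hsub, tatePairingPk_conjMap κ v n k ψv y _ hmem, hsub₁]
    exact ht k
  · -- values: apply `ψ` to the identity at `ψ⁻¹_* Q₀`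
    have hz : WeierstrassCurve.Affine.Point.zCoord
          (show (W.baseChange (AlgebraicClosure ℚ_[2])).toAffine.Point from
            (show localPoints W ℚ_[2] from
              WeierstrassCurve.Affine.Point.map (W' := W) gi
                (show (W.baseChange (AlgebraicClosure ℚ_[2])).toAffine.Point from Q₀))) =
        ψ⁻¹ • WeierstrassCurve.Affine.Point.zCoord (show (W.baseChange (AlgebraicClosure ℚ_[2])).toAffine.Point from Q₀) := by
      rw [← hgi]
      exact zCoord_map gi _
    have he : (g.comp e) xv = ψ • e xv := by rw [AlgHom.comp_apply, hg]
    have hfix : ψ • algebraMap ℚ_[2] (PadicAlgCl 2) (t : ℚ_[2]) = algebraMap ℚ_[2] (PadicAlgCl 2) (t : ℚ_[2]) :=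
      gal_smul_algebraMap ψ _
    rw [hz] at htval
    rw [← hfix, htval, kz_rhs_gal_smul, smul_inv_smul, he]

end Tower

/-! ## §3 The body of the fact under `e ↦ ψ ∘ e`: conjugate the Euler system -/

section Body

variable (v : HeightOneSpectrum (𝓞 ℚ)) (W : WeierstrassCurve ℚ) [W.IsElliptic] (κ : ZpExtension ℚ 2) (hκ : κ.IsCyclotomic)
  (f : CuspForm (Gamma0 (W.conductorNorm ℤ)) 2)
  [ContinuousSMul ℤ_[2] (W.tateModule 2)] [Module.Free ℤ_[2] (W.tateModule 2)] [Module.Finite ℤ_[2] (W.tateModule 2)]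

set_option backward.isDefEq.respectTransparency false in
/-- **FRAME-B (tower change by a Galois element).** Let `(Φ, φ)` be a continuous `2`-adic completion frame, `κ` cyclotomic,
`ψ ∈ G_{ℚ₂}` acting through the `ℚ`-algebra map `g`. If the body of `F` (from `∃ κ_K` on) holds at the tower `(e, τ)`, it holds at
the conjugated tower `(ψ ∘ e, ψ τ ψ⁻¹)` — with witnesses `(κ_K, Λ ∘ σ̃⁻¹, σ̃ • z, x)`, `σ̃ = resGalOfEmb closureEmb ψ_v`:
`ZetaBody` by `ZetaBodyRefit.zetaBody_refit_unconditional` (refit `θ = σ̃ + 0`), the (KZ) clause by `kz_clause_towerChange` at the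
point `ψ⁻¹_* Q₀` (its `Φ`-image `ψ_v⁻¹ • Φ_* Q₀` is again a layer point, and `|x|₂ > 1` is Galois-invariant).
[cite: Kato2004Asterisque, Thm. 12.5 (1) (pp. 221–222)] [cite: Rubin2000, Def. 2.1.1 and Ch. II §4] -/
theorem expStarTatePairing_body_towerChange
    (Φ : AlgebraicClosure ℚ_[2] ≃ₐ[ℚ] AlgebraicClosure (v.adicCompletion ℚ)) (φ : ℚ_[2] ≃+* v.adicCompletion ℚ)
    (hΦφ : ∀ y : ℚ_[2], Φ (algebraMap ℚ_[2] (AlgebraicClosure ℚ_[2]) y) =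
      algebraMap (v.adicCompletion ℚ) (AlgebraicClosure (v.adicCompletion ℚ)) (φ y))
    (ψ : Field.absoluteGaloisGroup ℚ_[2]) (g : AlgebraicClosure ℚ_[2] →ₐ[ℚ] AlgebraicClosure ℚ_[2]) (hg : ∀ x, g x = ψ • x)
    (e : ∀ k : ℕ, CyclotomicField (cycLevel 2 k ∅) ℚ →ₐ[ℚ] PadicAlgCl 2)
    (τ : ∀ m : ℕ, ZMod (2 ^ m) → Field.absoluteGaloisGroup ℚ_[2])
    (ιC : (m : ℕ) → (CyclotomicField m ℚ →+* ℂ))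
    (H : ∃ κK : ℝ, κK ≠ 0 ∧
      ∃ ΛK : ∀ (k : ℕ) (r : Finset (HeightOneSpectrum (𝓞 ℚ))),
          H1 (tateRep W 2) (cycSubgroup 2 k r) →ₗ[ℤ_[2]] ℚ_[2] ⊗[ℚ] CyclotomicField (cycLevel 2 k r) ℚ,
        ∀ (c d a : ℤ) (A : ℕ), 0 < A → Int.gcd c (6 * 2 * A) = 1 → Int.gcd d (6 * 2 * W.conductorNorm ℤ) = 1 →
          ∃ (z : ∀ (k : ℕ) (r : (cyclotomicLevelsRat 2 (badPlaces c d A (W.conductorNorm ℤ))).Ideals),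
                H1 (tateRep W 2) ((cyclotomicLevelsRat 2 (badPlaces c d A (W.conductorNorm ℤ))).level k r.1))
            (x : ∀ (k : ℕ) (r : (cyclotomicLevelsRat 2 (badPlaces c d A (W.conductorNorm ℤ))).Ideals),
                CyclotomicField (cycLevel 2 k r.1) ℚ),
            ZetaBody W 2 f ιC κK ΛK c d a A z x ∧
            ∀ (n : ℕ) (Q₀ : localPoints W ℚ_[2])
              (hQv : WeierstrassCurve.Affine.Point.map (W' := W)
                  (Φ : AlgebraicClosure ℚ_[2] →ₐ[ℚ] AlgebraicClosure (v.adicCompletion ℚ))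
                  (show (W.baseChange (AlgebraicClosure ℚ_[2])).toAffine.Point from Q₀) ∈
                localLayerPointsOfEmb κ (closureEmb (K := ℚ) (v.adicCompletion ℚ)) W n),
              (∀ (X Y : AlgebraicClosure ℚ_[2]) (hXY : (W.baseChange (AlgebraicClosure ℚ_[2])).toAffine.Nonsingular X Y),
                  (show (W.baseChange (AlgebraicClosure ℚ_[2])).toAffine.Point from Q₀) = .some X Y hXY → 1 < Valued.v X) →
              ∃ t : ℤ_[2],
                (∀ k : ℕ, CyclotomicLayer.tatePairingPk W κ v n k
                    (levelToLayerTwo W hκ (∅ : Set (HeightOneSpectrum (𝓞 ℚ))) n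
                      (z (n + 2) (cyclotomicLevelsRat 2 (badPlaces c d A (W.conductorNorm ℤ))).idealOne))
                    ⟨_, hQv⟩ = PadicInt.toZModPow k t) ∧
                algebraMap ℚ_[2] (PadicAlgCl 2) (t : ℚ_[2]) =
                  ∑ b : (ZMod (2 ^ (n + 2)))ˣ, τ (n + 2) (b : ZMod (2 ^ (n + 2))) •
                    ((∑' i : ℕ, algebraMap ℚ_[2] (PadicAlgCl 2) (PowerSeries.coeff i (W.map (algebraMap ℚ ℚ_[2])).formalLog) *
                        (WeierstrassCurve.Affine.Point.zCoord
                          (show (W.baseChange (AlgebraicClosure ℚ_[2])).toAffine.Point from Q₀)) ^ i) *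
                      e (n + 2) (x (n + 2) (cyclotomicLevelsRat 2 (badPlaces c d A (W.conductorNorm ℤ))).idealOne))) :
    ∃ κK : ℝ, κK ≠ 0 ∧
      ∃ ΛK : ∀ (k : ℕ) (r : Finset (HeightOneSpectrum (𝓞 ℚ))),
          H1 (tateRep W 2) (cycSubgroup 2 k r) →ₗ[ℤ_[2]] ℚ_[2] ⊗[ℚ] CyclotomicField (cycLevel 2 k r) ℚ,
        ∀ (c d a : ℤ) (A : ℕ), 0 < A → Int.gcd c (6 * 2 * A) = 1 → Int.gcd d (6 * 2 * W.conductorNorm ℤ) = 1 →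
          ∃ (z : ∀ (k : ℕ) (r : (cyclotomicLevelsRat 2 (badPlaces c d A (W.conductorNorm ℤ))).Ideals),
                H1 (tateRep W 2) ((cyclotomicLevelsRat 2 (badPlaces c d A (W.conductorNorm ℤ))).level k r.1))
            (x : ∀ (k : ℕ) (r : (cyclotomicLevelsRat 2 (badPlaces c d A (W.conductorNorm ℤ))).Ideals),
                CyclotomicField (cycLevel 2 k r.1) ℚ),
            ZetaBody W 2 f ιC κK ΛK c d a A z x ∧
            ∀ (n : ℕ) (Q₀ : localPoints W ℚ_[2])
              (hQv : WeierstrassCurve.Affine.Point.map (W' := W)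
                  (Φ : AlgebraicClosure ℚ_[2] →ₐ[ℚ] AlgebraicClosure (v.adicCompletion ℚ))
                  (show (W.baseChange (AlgebraicClosure ℚ_[2])).toAffine.Point from Q₀) ∈
                localLayerPointsOfEmb κ (closureEmb (K := ℚ) (v.adicCompletion ℚ)) W n),
              (∀ (X Y : AlgebraicClosure ℚ_[2]) (hXY : (W.baseChange (AlgebraicClosure ℚ_[2])).toAffine.Nonsingular X Y),
                  (show (W.baseChange (AlgebraicClosure ℚ_[2])).toAffine.Point from Q₀) = .some X Y hXY → 1 < Valued.v X) →
              ∃ t : ℤ_[2],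
                (∀ k : ℕ, CyclotomicLayer.tatePairingPk W κ v n k
                    (levelToLayerTwo W hκ (∅ : Set (HeightOneSpectrum (𝓞 ℚ))) n
                      (z (n + 2) (cyclotomicLevelsRat 2 (badPlaces c d A (W.conductorNorm ℤ))).idealOne))
                    ⟨_, hQv⟩ = PadicInt.toZModPow k t) ∧
                algebraMap ℚ_[2] (PadicAlgCl 2) (t : ℚ_[2]) =
                  ∑ b : (ZMod (2 ^ (n + 2)))ˣ, (ψ * τ (n + 2) (b : ZMod (2 ^ (n + 2))) * ψ⁻¹) •
                    ((∑' i : ℕ, algebraMap ℚ_[2] (PadicAlgCl 2) (PowerSeries.coeff i (W.map (algebraMap ℚ ℚ_[2])).formalLog) *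
                        (WeierstrassCurve.Affine.Point.zCoord
                          (show (W.baseChange (AlgebraicClosure ℚ_[2])).toAffine.Point from Q₀)) ^ i) *
                      (g.comp (e (n + 2))) (x (n + 2) (cyclotomicLevelsRat 2 (badPlaces c d A (W.conductorNorm ℤ))).idealOne)) := by
  -- transport `ψ` to `ψ_v ∈ Γ_v` and restrict to `σ̃ ∈ Γ_ℚ`
  obtain ⟨ψv, hψv⟩ := exists_localGal_over_frame Φ φ hΦφ ψ
  let σt : absoluteGaloisGroup ℚ := resGalOfEmb (closureEmb (K := ℚ) (v.adicCompletion ℚ)) ψv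
  -- the inverse of `ψ` as a `ℚ`-algebra map
  let gi : AlgebraicClosure ℚ_[2] →ₐ[ℚ] AlgebraicClosure ℚ_[2] :=
    ((AlgEquiv.restrictScalars ℚ (Field.absoluteGaloisGroup.toAlgEquiv ℚ_[2] ψ⁻¹) :
        AlgebraicClosure ℚ_[2] ≃ₐ[ℚ] AlgebraicClosure ℚ_[2]) : AlgebraicClosure ℚ_[2] →ₐ[ℚ] AlgebraicClosure ℚ_[2])
  have hgi : ∀ x, gi x = ψ⁻¹ • x := fun _ => rfl
  obtain ⟨κK, hκK, ΛK, hmain⟩ := H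
  -- the refit functionals `Λ' = Λ ∘ σ̃⁻¹` (group-ring refit at `c₀ = 0`)
  choose Λ' hΛ' using fun (k : ℕ) (r : Finset (HeightOneSpectrum (𝓞 ℚ))) =>
    ZetaBodyRefit.exists_refit_functional (cycSubgroup 2 k r) (ΛK k r) σt (0 : ℤ_[2]) ((cycSubgroup 2 k r).index)
  refine ⟨κK, hκK, Λ', fun c d a A hA hc hd => ?_⟩
  obtain ⟨z, x, hbody, hKZ⟩ := hmain c d a A hA hc hd
  -- the conjugated Euler system `σ̃ • z (+ 0 • z)`
  refine ⟨fun k r => conjMap (tateRep W 2).toTopRep (cycSubgroup 2 k r.1) σt 1 (z k r) +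
    (0 : ℤ_[2]) • (show H1 (tateRep W 2) (cycSubgroup 2 k r.1) from z k r), x, ?_, ?_⟩
  · -- `ZetaBody` is transported by the refit
    refine ZetaBodyRefit.zetaBody_refit_unconditional (z := z) (fun k r => rfl) hΛ' (fun k r => ?_) hbody
    rw [neg_zero, PadicInt.coe_zero, zero_pow (ZetaBodyRefit.index_cycSubgroup_ne_zero k r), sub_zero]
    exact one_ne_zero
  · -- the (KZ) clause at `Q₀` from the (KZ) clause at `ψ⁻¹_* Q₀`
    intro n Q₀ hQv hformal
    have hpt := map_frame_map_galInv (W := W) Φ ψ ψv hψv gi hgi (show (W.baseChange (AlgebraicClosure ℚ_[2])).toAffine.Point from Q₀)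
    have hQv₁ : WeierstrassCurve.Affine.Point.map (W' := W)
        (Φ : AlgebraicClosure ℚ_[2] →ₐ[ℚ] AlgebraicClosure (v.adicCompletion ℚ))
        (show (W.baseChange (AlgebraicClosure ℚ_[2])).toAffine.Point from
          (show localPoints W ℚ_[2] from
            WeierstrassCurve.Affine.Point.map (W' := W) gi (show (W.baseChange (AlgebraicClosure ℚ_[2])).toAffine.Point from Q₀))) ∈
        localLayerPointsOfEmb κ (closureEmb (K := ℚ) (v.adicCompletion ℚ)) W n := by
      rw [show WeierstrassCurve.Affine.Point.map (W' := W)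
          (Φ : AlgebraicClosure ℚ_[2] →ₐ[ℚ] AlgebraicClosure (v.adicCompletion ℚ))
          (show (W.baseChange (AlgebraicClosure ℚ_[2])).toAffine.Point from
            (show localPoints W ℚ_[2] from
              WeierstrassCurve.Affine.Point.map (W' := W) gi (show (W.baseChange (AlgebraicClosure ℚ_[2])).toAffine.Point from Q₀))) =
          _ from hpt]
      exact smul_mem_localLayerPointsOfEmb κ (closureEmb (K := ℚ) (v.adicCompletion ℚ)) W n ψv⁻¹ hQv
    obtain ⟨t, ht, htval⟩ := hKZ n (show localPoints W ℚ_[2] from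
        WeierstrassCurve.Affine.Point.map (W' := W) gi (show (W.baseChange (AlgebraicClosure ℚ_[2])).toAffine.Point from Q₀))
      hQv₁ (formal_condition_map_gal ψ⁻¹ gi hgi _ hformal)
    refine ⟨t, ?_⟩
    -- `Cor (σ̃ • z + 0 • z) = σ̃ • Cor z`
    have hcor : levelToLayerTwo W hκ (∅ : Set (HeightOneSpectrum (𝓞 ℚ))) n
        (conjMap (tateRep W 2).toTopRep (cycSubgroup 2 (n + 2) (cyclotomicLevelsRat 2 (badPlaces c d A (W.conductorNorm ℤ))).idealOne.1)
            σt 1 (z (n + 2) (cyclotomicLevelsRat 2 (badPlaces c d A (W.conductorNorm ℤ))).idealOne) +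
          (0 : ℤ_[2]) • (show H1 (tateRep W 2) (cycSubgroup 2 (n + 2) (cyclotomicLevelsRat 2 (badPlaces c d A (W.conductorNorm ℤ))).idealOne.1)
            from z (n + 2) (cyclotomicLevelsRat 2 (badPlaces c d A (W.conductorNorm ℤ))).idealOne)) =
        conjMap (tateRep W 2).toTopRep (κ.layerSubgroup n) σt 1
          (levelToLayerTwo W hκ (∅ : Set (HeightOneSpectrum (𝓞 ℚ))) n
            (z (n + 2) (cyclotomicLevelsRat 2 (badPlaces c d A (W.conductorNorm ℤ))).idealOne)) := by
      rw [zero_smul, add_zero]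
      exact levelToLayerTwo_conjMap hκ ∅ n σt _
    rw [hcor]
    exact kz_clause_towerChange κ Φ ψ ψv hψv g gi hg hgi (e (n + 2)) (τ (n + 2)) _ _ _ Q₀ hQv hQv₁ t ht htval

end Body

end Summit.BirchSwinnertonDyer.BirchSwinnertonDyer.Theorems.SignedKatoOffTwo.FrameChange

end
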